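import Literature.Probability.LatticeModels.AnchoredClusterExpansion
import HarnessLib

/-!
# Small activities with an anchored Kotecký–Preiss weight `a`: zero-freeness, logarithm, anchored
# tails, and the two-gas pressure comparison

Bounds for model classes (abstract polymer gases on the finite subsets of a site type); no claim about
any Hamiltonian, no materials claim.

The sibling file `AnchoredClusterExpansion` records the one-site Kotecký–Preiss condition with the
anchored weight `a(A) = |A|` (`IsSmallActivity ρ δ`: `Σ_{A ∋ x} |ρ(A)| e^{(1+δ)|A|} ≤ 1`) and its
consequences. Kotecký–Preiss [KoteckyPreiss1986, Theorem p. 492] allow any weight function `a`; this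
file carries the weight `a(A) = a|A|` with an arbitrary constant `a > 0` through the same statements:

* `IsSmallActivityA ρ a δ`: `ρ ∅ = 0`, `a > 0`, `δ > 0`, and `Σ_{A ∋ x} |ρ(A)| e^{(a+δ)|A|} ≤ a` for
  every site `x` and every finite family of polymers through `x` (hypothesis (1) of [KP86] with
  `a = a|·|`, `d = δ|·|` at the polymer `{x}`); `IsSmallActivityA.of_isSmallActivity`: the sibling's
  notion is the case `a = 1`;
* `kp_hypothesis` (`Σ_{γ' ι γ} |ρ(γ')| e^{a|γ'|+δ|γ'|} ≤ a|γ|`), `isKPVolume`,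
  `polymerPartitionFunction_ne_zero` (`Ξ_𝒱(ρ) ≠ 0`), `exp_polymerLogZ` (`exp (log Ξ) = Ξ`),
  `sum_norm_truncatedWeight_anchored_le` (`Σ_{C ∋ x} |Φ^T(C)| ≤ a`) and the anchored tail
  `sum_norm_truncatedWeight_anchored_ge_le` (`Σ_{C ∋ x, ‖C‖ ≥ R} |Φ^T(C)| ≤ a e^{-δR}`), all read off
  the general Kotecký–Preiss theorem of `ClusterExpansionKPBound` exactly as in the sibling file;
* the two-gas comparison: `sum_norm_truncatedWeight_meeting_large_le` (on a finite site type the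
  truncated functionals of the families meeting a polymer with `≥ R` sites total `≤ |α| a e^{-δR}`)
  and `norm_polymerLogZ_sub_le_of_eq_of_card_lt`: two `IsSmallActivityA · a δ` gases that agree on
  the polymers with fewer than `R` sites have `|log Ξ(ρ) - log Ξ(ρ')| ≤ 2a|α| e^{-δR}`
  ([KP86] (2), (4) and Proposition (i): the difference of the two cluster expansions only sees
  clusters containing a large polymer).

Why the weight matters (design note): when the activities come from a tree-graph (Catalan) entropy
bound `Σ_{X ∋ x connected} (∏ w_b) e^{c|supp X|} ≤ F - e^{c}` under `e^{c} + W F² ≤ F`, the one-site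
condition with weight `a` reads `W (e^{a+δ} + a)² ≤ a`; the optimum `a ≈ 3/8` improves the admissible
weighted degree `W` by a factor `≈ 1.55` over `a = 1`. Deliberately NOT here: infinite site types
(the two-gas comparison is stated for `[Fintype α]`; the anchored estimates only need `[Countable α]`),
general weight functions `a(·)` (only the linear ones `a|·|`), translation-invariant pressures.

References: R. Kotecký, D. Preiss, Comm. Math. Phys. 103 (1986) 491–498, Theorem p. 492 (1), (2), (4)
and Proposition (i) p. 493.
-/

namespace Literature.Probability.LatticeModels

open Finset

/-! ### Small activities with weight `a` -/

section Small

variable {α : Type*} [DecidableEq α]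

/-- **Small activities with anchored weight `a`** on the subset polymers of `α`, one-site
Kotecký–Preiss form: `ρ ∅ = 0`, `a > 0`, `δ > 0`, and `Σ_{A ∋ x} |ρ(A)| e^{(a+δ)|A|} ≤ a` for every
finite family of polymers through a site `x` (hypothesis (1) of [KP86] with `a = a|·|`, `d = δ|·|` at
the polymer `{x}`). [cite: KoteckyPreiss1986, Theorem p. 492, hypothesis (1)] -/
structure IsSmallActivityA (ρ : Finset α → ℂ) (a δ : ℝ) : Prop where
  /-- the empty polymer carries no activity -/
  rho_empty : ρ ∅ = 0
  /-- the anchored weight is positive -/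
  a_pos : 0 < a
  /-- the decay rate is positive -/
  delta_pos : 0 < δ
  /-- the one-site Kotecký–Preiss smallness with weight `a` -/
  sum_le : ∀ (x : α) (𝒜 : Finset (Finset α)), (∀ A ∈ 𝒜, x ∈ A) →
    ∑ A ∈ 𝒜, ‖ρ A‖ * Real.exp ((a + δ) * A.card) ≤ a

namespace IsSmallActivityA

variable {ρ : Finset α → ℂ} {a δ : ℝ}

omit [DecidableEq α] in
/-- The sibling notion `IsSmallActivity ρ δ` is the case `a = 1`. [cite: KoteckyPreiss1986, Theorem p. 492, hypothesis (1)] -/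
theorem of_isSmallActivity (h : IsSmallActivity ρ δ) : IsSmallActivityA ρ 1 δ where
  rho_empty := h.rho_empty
  a_pos := one_pos
  delta_pos := h.delta_pos
  sum_le x 𝒜 h𝒜 := h.sum_le_one x 𝒜 h𝒜

/-- Hypothesis (1) of [KP86] with `a(A) = a|A|`, `d(A) = δ|A|`: for every polymer `γ`,
`Σ_{γ' ι γ} |ρ(γ')| e^{a|γ'| + δ|γ'|} ≤ a|γ|` (sum over ALL polymers incompatible with `γ`,
absolutely convergent). [cite: KoteckyPreiss1986, Theorem p. 492, hypothesis (1)] -/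
theorem kp_hypothesis (h : IsSmallActivityA ρ a δ) (γ : Finset α) :
    Summable (fun γ' : {γ' : Finset α // polyInc γ' γ} =>
        ‖ρ γ'‖ * Real.exp (a * (γ' : Finset α).card + δ * (γ' : Finset α).card)) ∧
      ∑' γ' : {γ' : Finset α // polyInc γ' γ},
        ‖ρ γ'‖ * Real.exp (a * (γ' : Finset α).card + δ * (γ' : Finset α).card) ≤ a * γ.card := by
  set f : {γ' : Finset α // polyInc γ' γ} → ℝ := fun γ' =>
    ‖ρ γ'‖ * Real.exp (a * (γ' : Finset α).card + δ * (γ' : Finset α).card) with hf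
  have hnn : ∀ x, 0 ≤ f x := fun x => mul_nonneg (norm_nonneg _) (Real.exp_nonneg _)
  -- bound on finite partial sums
  have key : ∀ S : Finset {γ' : Finset α // polyInc γ' γ}, ∑ x ∈ S, f x ≤ a * γ.card := by
    intro S
    set 𝒜 : Finset (Finset α) := (S.map (Function.Embedding.subtype _)).filter fun A => A.Nonempty with h𝒜
    have hterm : ∀ A : Finset α, ‖ρ A‖ * Real.exp (a * (A.card : ℝ) + δ * A.card) =
        ‖ρ A‖ * Real.exp ((a + δ) * A.card) := fun A => by ring_nf
    calc ∑ x ∈ S, f x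
        = ∑ A ∈ S.map (Function.Embedding.subtype _), ‖ρ A‖ * Real.exp ((a + δ) * A.card) := by
          rw [Finset.sum_map]
          exact Finset.sum_congr rfl fun x _ => hterm x
      _ = ∑ A ∈ 𝒜, ‖ρ A‖ * Real.exp ((a + δ) * A.card) := by
          rw [h𝒜, Finset.sum_filter]
          refine Finset.sum_congr rfl fun A _ => ?_
          split_ifs with hA
          · rfl
          · rw [Finset.not_nonempty_iff_eq_empty.1 hA, h.rho_empty, norm_zero, zero_mul]
      _ ≤ ∑ x ∈ γ, ∑ A ∈ 𝒜 with x ∈ A, ‖ρ A‖ * Real.exp ((a + δ) * A.card) := by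
          have hcover : ∀ A ∈ 𝒜, ∃ x ∈ γ, x ∈ A := by
            intro A hA
            rw [h𝒜, Finset.mem_filter, Finset.mem_map] at hA
            obtain ⟨⟨y, hy, rfl⟩, hne⟩ := hA
            rcases y.2 with hEq | ⟨x, hx⟩
            · obtain ⟨x, hx⟩ := hne
              exact ⟨x, hEq ▸ hx, hx⟩
            · exact ⟨x, (Finset.mem_inter.1 hx).2, (Finset.mem_inter.1 hx).1⟩
          calc ∑ A ∈ 𝒜, ‖ρ A‖ * Real.exp ((a + δ) * A.card)
              ≤ ∑ A ∈ 𝒜, ∑ x ∈ γ with x ∈ A, ‖ρ A‖ * Real.exp ((a + δ) * A.card) := by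
                refine Finset.sum_le_sum fun A hA => ?_
                rw [Finset.sum_const, nsmul_eq_mul]
                obtain ⟨x, hxγ, hxA⟩ := hcover A hA
                have h1 : (1 : ℝ) ≤ (γ.filter fun x => x ∈ A).card := by
                  exact_mod_cast Finset.card_pos.2 ⟨x, Finset.mem_filter.2 ⟨hxγ, hxA⟩⟩
                have h0 : 0 ≤ ‖ρ A‖ * Real.exp ((a + δ) * A.card) :=
                  mul_nonneg (norm_nonneg _) (Real.exp_nonneg _)
                nlinarith
            _ = ∑ x ∈ γ, ∑ A ∈ 𝒜 with x ∈ A, ‖ρ A‖ * Real.exp ((a + δ) * A.card) := by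
                rw [Finset.sum_comm' (t' := γ) (s' := fun x => 𝒜.filter fun A => x ∈ A)]
                intro A x
                simp only [Finset.mem_filter]
                tauto
      _ ≤ ∑ _x ∈ γ, a := Finset.sum_le_sum fun x _ =>
          h.sum_le x _ fun A hA => (Finset.mem_filter.1 hA).2
      _ = a * γ.card := by rw [Finset.sum_const, nsmul_eq_mul, mul_comm]
  exact ⟨summable_of_sum_le hnn key, Real.tsum_le_of_sum_le hnn key⟩

/-- Every finite volume is a Kotecký–Preiss volume for `a = a|·|`. [cite: KoteckyPreiss1986, Theorem p. 492, hypothesis (1)] -/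
theorem isKPVolume (h : IsSmallActivityA ρ a δ) (𝒱 : Finset (Finset α)) :
    IsKPVolume polyInc ρ (fun A : Finset α => a * (A.card : ℝ)) 𝒱 :=
  isKPVolume_of_tsum_le (inc := polyInc) (w := ρ) (a := fun A : Finset α => a * (A.card : ℝ))
    (d := fun A : Finset α => δ * (A.card : ℝ))
    (fun _ => mul_nonneg h.delta_pos.le (Nat.cast_nonneg _)) (fun γ => h.kp_hypothesis γ) 𝒱

/-- **Zero-freeness**: no finite-volume partition function vanishes. [cite: KoteckyPreiss1986, Theorem p. 492 (Z ≠ 0)] -/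
theorem polymerPartitionFunction_ne_zero (h : IsSmallActivityA ρ a δ) (𝒱 : Finset (Finset α)) :
    polymerPartitionFunction polyInc ρ 𝒱 ≠ 0 :=
  polymerPartitionFunction_ne_zero_of_kp (h.isKPVolume 𝒱) Finset.Subset.rfl

/-- **The Kotecký–Preiss branch is a logarithm** in every finite volume: `exp (log Ξ(𝒱)) = Ξ(𝒱)`.
[cite: KoteckyPreiss1986, Theorem p. 492 (Z ≠ 0 and (2))] -/
theorem exp_polymerLogZ (h : IsSmallActivityA ρ a δ) (𝒱 : Finset (Finset α)) :
    Complex.exp (polymerLogZ polyInc ρ 𝒱) = polymerPartitionFunction polyInc ρ 𝒱 :=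
  exp_polymerLogZ_of_kp (h.isKPVolume 𝒱) Finset.Subset.rfl

/-- **Anchored sums are bounded by the weight**: `Σ_{C : x ∈ ⋃C} |Φ^T(C)| ≤ a` for any finite
family of families. [cite: KoteckyPreiss1986, Theorem p. 492, estimate (4)] -/
theorem sum_norm_truncatedWeight_anchored_le [Countable α] (h : IsSmallActivityA ρ a δ) (x : α)
    (𝒞 : Finset (Finset (Finset α))) :
    ∑ C ∈ 𝒞 with x ∈ clusterSupp C, ‖truncatedWeight polyInc ρ C‖ ≤ a := by
  classical
  have hb := sum_norm_truncatedWeight_le_of_touches (inc := polyInc) (w := ρ)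
    (koteckyPreiss_truncatedWeight_bound_holds polyInc ρ (fun A : Finset α => a * (A.card : ℝ))
      (fun A => δ * A.card))
    (fun _ => mul_nonneg h.a_pos.le (Nat.cast_nonneg _))
    (fun A => mul_nonneg h.delta_pos.le (Nat.cast_nonneg _))
    (fun γ => h.kp_hypothesis γ) 𝒞 {x}
  have hset : (𝒞.filter fun C => x ∈ clusterSupp C) = 𝒞.filter fun C => KPTouches polyInc C {x} :=
    Finset.filter_congr fun C _ => kpTouches_polyInc_singleton_iff.symm
  rw [hset]
  refine hb.trans (le_of_eq ?_)
  simp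

/-- **The anchored tail bound with weight `a`**: the families through `x` of total size `‖C‖ ≥ R`
have `Σ |Φ^T(C)| ≤ a e^{-δR}`. [cite: KoteckyPreiss1986, Theorem p. 492, estimate (4)] -/
theorem sum_norm_truncatedWeight_anchored_ge_le [Countable α] (h : IsSmallActivityA ρ a δ) (x : α)
    (𝒞 : Finset (Finset (Finset α))) (R : ℝ) :
    ∑ C ∈ 𝒞 with (x ∈ clusterSupp C ∧ R ≤ ∑ A ∈ C, (A.card : ℝ)), ‖truncatedWeight polyInc ρ C‖ ≤
      a * Real.exp (-(δ * R)) := by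
  classical
  set 𝒞' := 𝒞.filter fun C => R ≤ ∑ A ∈ C, (A.card : ℝ) with h𝒞'
  have hb := sum_norm_truncatedWeight_le_exp_neg_of_touches (inc := polyInc) (w := ρ)
    (koteckyPreiss_truncatedWeight_bound_holds polyInc ρ (fun A : Finset α => a * (A.card : ℝ))
      (fun A => δ * A.card))
    (fun _ => mul_nonneg h.a_pos.le (Nat.cast_nonneg _))
    (fun A => mul_nonneg h.delta_pos.le (Nat.cast_nonneg _))
    (fun γ => h.kp_hypothesis γ) 𝒞' {x} (r := δ * R) (fun C hC _ => by
      rw [← Finset.mul_sum]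
      exact mul_le_mul_of_nonneg_left (Finset.mem_filter.1 hC).2 h.delta_pos.le)
  have hset : (𝒞.filter fun C => x ∈ clusterSupp C ∧ R ≤ ∑ A ∈ C, (A.card : ℝ)) =
      𝒞'.filter fun C => KPTouches polyInc C {x} := by
    rw [h𝒞', Finset.filter_filter]
    exact Finset.filter_congr fun C _ => by rw [kpTouches_polyInc_singleton_iff, and_comm]
  rw [hset]
  refine hb.trans (le_of_eq ?_)
  simp [mul_comm]

end IsSmallActivityA

end Small

/-! ### Two weighted small gases that agree on small polymers -/

section TwoGas

variable {α : Type*} [DecidableEq α] [Fintype α]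

namespace IsSmallActivityA

/-- **Union bound over anchors (weight `a`).** For `IsSmallActivityA ρ a δ`, the truncated functionals
of the families `C ⊆ 𝒱` meeting the polymers of `𝒱` with at least `R > 0` sites have total size
`≤ |α| a e^{-δR}`. [cite: KoteckyPreiss1986, Theorem p. 492, estimate (4)] -/
theorem sum_norm_truncatedWeight_meeting_large_le {ρ : Finset α → ℂ} {a δ : ℝ}
    (h : IsSmallActivityA ρ a δ) (𝒱 : Finset (Finset α)) {R : ℝ} (hR : 0 < R) :
    ∑ C ∈ 𝒱.powerset with (C ∩ (𝒱.filter fun A => R ≤ (A.card : ℝ))).Nonempty,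
        ‖truncatedWeight polyInc ρ C‖ ≤ Fintype.card α * (a * Real.exp (-(δ * R))) := by
  have hcover : ∀ C ∈ 𝒱.powerset.filter
      (fun C => (C ∩ (𝒱.filter fun A => R ≤ (A.card : ℝ))).Nonempty),
      ∃ x : α, x ∈ clusterSupp C ∧ R ≤ ∑ A ∈ C, (A.card : ℝ) := by
    intro C hC
    obtain ⟨A, hA⟩ := (Finset.mem_filter.1 hC).2
    rw [Finset.mem_inter] at hA
    have hRA : R ≤ (A.card : ℝ) := (Finset.mem_filter.1 hA.2).2
    have hAne : A.Nonempty := by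
      rw [← Finset.card_pos]
      exact_mod_cast hR.trans_le hRA
    obtain ⟨x, hx⟩ := hAne
    refine ⟨x, mem_clusterSupp.2 ⟨A, hA.1, hx⟩, hRA.trans ?_⟩
    exact Finset.single_le_sum (f := fun A : Finset α => (A.card : ℝ)) (fun _ _ => Nat.cast_nonneg _) hA.1
  calc ∑ C ∈ 𝒱.powerset with (C ∩ (𝒱.filter fun A => R ≤ (A.card : ℝ))).Nonempty,
        ‖truncatedWeight polyInc ρ C‖
      ≤ ∑ C ∈ 𝒱.powerset with (C ∩ (𝒱.filter fun A => R ≤ (A.card : ℝ))).Nonempty,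
          ∑ x ∈ (Finset.univ : Finset α) with (x ∈ clusterSupp C ∧ R ≤ ∑ A ∈ C, (A.card : ℝ)),
            ‖truncatedWeight polyInc ρ C‖ := by
        refine Finset.sum_le_sum fun C hC => ?_
        rw [Finset.sum_const, nsmul_eq_mul]
        obtain ⟨x, hx⟩ := hcover C hC
        have hmem : x ∈ (Finset.univ : Finset α).filter
            (fun x => x ∈ clusterSupp C ∧ R ≤ ∑ A ∈ C, (A.card : ℝ)) :=
          Finset.mem_filter.2 ⟨Finset.mem_univ _, hx⟩
        have h1 : (1 : ℝ) ≤ ((Finset.univ : Finset α).filter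
            (fun x => x ∈ clusterSupp C ∧ R ≤ ∑ A ∈ C, (A.card : ℝ))).card :=
          Nat.one_le_cast.2 (Finset.card_pos.2 ⟨x, hmem⟩)
        nlinarith [norm_nonneg (truncatedWeight polyInc ρ C)]
    _ = ∑ x ∈ (Finset.univ : Finset α),
          ∑ C ∈ (𝒱.powerset.filter fun C => (C ∩ (𝒱.filter fun A => R ≤ (A.card : ℝ))).Nonempty)
            with (x ∈ clusterSupp C ∧ R ≤ ∑ A ∈ C, (A.card : ℝ)), ‖truncatedWeight polyInc ρ C‖ := by
        rw [Finset.sum_comm' (t' := (Finset.univ : Finset α))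
          (s' := fun x => (𝒱.powerset.filter fun C =>
            (C ∩ (𝒱.filter fun A => R ≤ (A.card : ℝ))).Nonempty).filter
              fun C => x ∈ clusterSupp C ∧ R ≤ ∑ A ∈ C, (A.card : ℝ))]
        intro C x
        simp only [Finset.mem_filter, Finset.mem_univ, true_and, and_true]
        try tauto
    _ ≤ ∑ x ∈ (Finset.univ : Finset α),
          ∑ C ∈ 𝒱.powerset with (x ∈ clusterSupp C ∧ R ≤ ∑ A ∈ C, (A.card : ℝ)),
            ‖truncatedWeight polyInc ρ C‖ := by
        refine Finset.sum_le_sum fun x _ => Finset.sum_le_sum_of_subset_of_nonneg (fun C hC => ?_)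
          fun C _ _ => norm_nonneg _
        simp only [Finset.mem_filter] at hC ⊢
        exact ⟨hC.1.1, hC.2⟩
    _ ≤ ∑ _x ∈ (Finset.univ : Finset α), a * Real.exp (-(δ * R)) :=
        Finset.sum_le_sum fun x _ => h.sum_norm_truncatedWeight_anchored_ge_le x 𝒱.powerset R
    _ = Fintype.card α * (a * Real.exp (-(δ * R))) := by
        rw [Finset.sum_const, nsmul_eq_mul, Finset.card_univ]

/-- **Two weighted small polymer gases that agree on small polymers have close pressures.** If
`ρ, ρ'` satisfy `IsSmallActivityA · a δ` on the subsets of a finite site set and `ρ A = ρ' A` for every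
polymer `A` of the volume `𝒱` with fewer than `R > 0` sites, then
`|log Ξ_𝒱(ρ) - log Ξ_𝒱(ρ')| ≤ 2a |α| e^{-δR}` (Kotecký–Preiss logarithms).
[cite: KoteckyPreiss1986, Theorem p. 492 (2), (4) and Proposition (i)] -/
theorem norm_polymerLogZ_sub_le_of_eq_of_card_lt {ρ ρ' : Finset α → ℂ} {a δ : ℝ}
    (h : IsSmallActivityA ρ a δ) (h' : IsSmallActivityA ρ' a δ) (𝒱 : Finset (Finset α)) {R : ℝ}
    (hR : 0 < R) (hagree : ∀ A ∈ 𝒱, (A.card : ℝ) < R → ρ A = ρ' A) :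
    ‖polymerLogZ polyInc ρ 𝒱 - polymerLogZ polyInc ρ' 𝒱‖ ≤
      2 * a * Fintype.card α * Real.exp (-(δ * R)) := by
  have hT : ∀ γ ∈ 𝒱, γ ∉ (𝒱.filter fun A => R ≤ (A.card : ℝ)) → ρ γ = ρ' γ :=
    fun γ hγ hγT => hagree γ hγ (lt_of_not_ge fun hle => hγT (Finset.mem_filter.2 ⟨hγ, hle⟩))
  rw [polymerLogZ_sub_eq_sum_filter 𝒱 _ hT]
  calc ‖∑ C ∈ 𝒱.powerset with (C ∩ (𝒱.filter fun A => R ≤ (A.card : ℝ))).Nonempty,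
          (truncatedWeight polyInc ρ C - truncatedWeight polyInc ρ' C)‖
      ≤ ∑ C ∈ 𝒱.powerset with (C ∩ (𝒱.filter fun A => R ≤ (A.card : ℝ))).Nonempty,
          ‖truncatedWeight polyInc ρ C - truncatedWeight polyInc ρ' C‖ := norm_sum_le _ _
    _ ≤ ∑ C ∈ 𝒱.powerset with (C ∩ (𝒱.filter fun A => R ≤ (A.card : ℝ))).Nonempty,
          (‖truncatedWeight polyInc ρ C‖ + ‖truncatedWeight polyInc ρ' C‖) :=
        Finset.sum_le_sum fun C _ => norm_sub_le _ _
    _ = (∑ C ∈ 𝒱.powerset with (C ∩ (𝒱.filter fun A => R ≤ (A.card : ℝ))).Nonempty,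
          ‖truncatedWeight polyInc ρ C‖) +
        ∑ C ∈ 𝒱.powerset with (C ∩ (𝒱.filter fun A => R ≤ (A.card : ℝ))).Nonempty,
          ‖truncatedWeight polyInc ρ' C‖ := Finset.sum_add_distrib
    _ ≤ Fintype.card α * (a * Real.exp (-(δ * R))) + Fintype.card α * (a * Real.exp (-(δ * R))) :=
        add_le_add (h.sum_norm_truncatedWeight_meeting_large_le 𝒱 hR)
          (h'.sum_norm_truncatedWeight_meeting_large_le 𝒱 hR)
    _ = 2 * a * Fintype.card α * Real.exp (-(δ * R)) := by ring

end IsSmallActivityA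

end TwoGas

end Literature.Probability.LatticeModels
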